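import Literature.NumberTheory.EllipticCurves.IsogenyRealPeriodProofs
import Literature.NumberTheory.EllipticCurves.IsogenyRationalPointsBaseChangeProofs
import Literature.NumberTheory.EllipticCurves.BSDSelmerSmithNoRationalTwoTorsionProofs
import Literature.NumberTheory.EllipticCurves.ComplexTorusAddProofs
import Literature.NumberTheory.EllipticCurves.ModularCurve
import Summits.BirchSwinnertonDyer.Rank1Residual.Supersingular.TamParityChi8Link
import HarnessLib

/-!
# Crux `ThetaLayerLambdaCongruenceAtTwo` (stmt-BirchSwinnertonDyer-20688, route ResidualThetaTransportAtTwo), line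
# `birth` v9, stub (C3k), plan ITEM B5: DISCHARGE OF THE BRIDGE HYPOTHESIS (H2) — a cyclic `ℚ`-isogeny out of a
# curve that is good supersingular at `2` has ODD degree, and an isogeny of degree `m` is a REAL multiplier
# `αΛ_W ⊆ Λ_A` with `m·Λ_A ⊆ αΛ_W` on Néron lattices (width seat bsd-wall-rtt-p3-w3 g3;
# `--supports stmt-BirchSwinnertonDyer-20688 --as helper`; closes nothing)

HONEST FRAMING. THEOREMS only, over the tree's `WeierstrassCurve.Isogeny` (isogenies on geometric points),
`ratTwoTorsionCard`, `IsNeronLatticeOf`, and the PROVED analytic theorem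
`Isogeny.exists_mul_baseChange_apply_eq` (Silverman AEC VI.4.1(b): `#ker ψ = [Λ' : αΛ]`). No definition, no named
fact. Which isogeny exists (e.g. Mazur–Kenku's cyclic one, `mazurKenku_exists_cyclic_isogeny`) is NOT asserted
here. BSD is not proved by any of this.

WHAT.
* §1 `ratTwoTorsionCard_eq_one_of_goodSS_two`: a globally minimal `W/ℚ` with good supersingular reduction at `2`
  has NO rational `2`-torsion (`#E(ℚ)[2] = 1`): its minimal model has `a₁` even, `a₃` odd (tree
  `even_a₁_and_odd_a₃_of_goodSS_two`), so the `2`-division cubic `4x³ + b₂x² + 2b₄x + b₆` has `b₂ ≡ 2b₄ ≡ 0 (4)`,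
  `b₆` odd and no rational root (`cubic_ne_zero_of_odd_const`), whence the tree's
  `ratTwoTorsionCard_eq_one_of_forall_not_isRoot`.
* §2 `Isogeny.exists_fixed_twoTorsion_of_isCyclic_of_even_degree`, `Isogeny.odd_degree_of_isCyclic_of_
  ratTwoTorsionCard_eq_one`: a CYCLIC isogeny `ψ : W → W'` over a field `K` of EVEN degree has a non-zero
  `Γ_K`-fixed point of order `2` in its kernel (the unique element of order `2` of the `Γ_K`-stable cyclic group
  `ker ψ`); so over `ℚ`, `#E(ℚ)[2] = 1` forces every cyclic `ℚ`-isogeny out of `W` to have odd degree.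
* §3 `Isogeny.exists_real_mul_lattice_le_of_isNeronLatticeOf`: for ANY `ℚ`-isogeny `ψ : W → A` of elliptic curves
  and Néron period pairs `L_W, L_A` (`g₂ = c₄/12`, `g₃ = c₆/216`) there is a REAL `α ≠ 0` with `αΛ_W ⊆ Λ_A` and
  `(deg ψ)·Λ_A ⊆ αΛ_W` (`α` is the multiplier `ψ^*ω_A/ω_W`, real because `ψ` commutes with complex conjugation;
  the index statement is `#ker ψ_ℂ = [Λ_A : αΛ_W]` with `#ker ψ_ℂ = #ker ψ = deg ψ`).
* §4 `exists_real_oddIndex_latticeBridge_of_goodSS_two`: (H2) of `…StarBridge` — for `W` good supersingular at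
  `2` and a CYCLIC `ℚ`-isogeny `W → A`: `∃ α ∈ ℝ^×, m odd, αΛ_W ⊆ Λ_A ∧ m·Λ_A ⊆ αΛ_W`.

References: [SilvermanAEC2009] III.4 (degree, cyclic kernels), III.6.4, VI.4.1(b), VI.5.3, VII.3, VIII.§1;
[CremonaAlgorithms1997] §2.10, §3.7.
-/

noncomputable section

-- justification: the `Summit.BirchSwinnertonDyer.BirchSwinnertonDyer.…` path repeats a component (route-file convention)
set_option linter.dupNamespace false

open scoped Classical ComplexConjugate

open Complex WeierstrassCurve
open Literature.NumberTheory.EllipticCurves Literature.NumberTheory.EllipticCurves.ModularForms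
open Literature.NumberTheory.EllipticCurves.Rank1Residual

namespace Summit.BirchSwinnertonDyer.BirchSwinnertonDyer.Theorems.ThetaLayerLambdaCongruenceAtTwo

/-! ## §1. Good supersingular at `2` ⇒ no rational `2`-torsion -/

section NoTwoTorsion

/-- **Parity lemma.** For integers `A, B, C` with `C` odd, `4x³ + 4Ax² + 4Bx + C` has no rational root (writing
`x = p/q` in lowest terms, `q` must be even, and then `p` must be even). The tree's private
`cubic_ne_zero_of_odd` (`BSDSelmerSmithNoRationalTwoTorsionCMProofs`), re-proved. [folklore] -/
theorem cubic_ne_zero_of_odd_const (A B C : ℤ) (hC : Odd C) (x : ℚ) :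
    4 * x ^ 3 + 4 * A * x ^ 2 + 4 * B * x + C ≠ 0 := by
  intro hx
  set p : ℤ := x.num with hp_def
  set q : ℕ := x.den with hq_def
  have hq0 : (q : ℚ) ≠ 0 := by exact_mod_cast x.den_nz
  have hxq : x = p / q := (Rat.num_div_den x).symm
  have hp : (p : ℚ) = x * (q : ℚ) := by rw [hxq, div_mul_cancel₀ _ hq0]
  have h' : ((4 * p ^ 3 + 4 * A * p ^ 2 * q + 4 * B * p * q ^ 2 + C * q ^ 3 : ℤ) : ℚ) = 0 := by
    push_cast
    rw [hp]
    linear_combination (q : ℚ) ^ 3 * hx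
  have hZ : 4 * p ^ 3 + 4 * A * p ^ 2 * q + 4 * B * p * q ^ 2 + C * (q : ℤ) ^ 3 = 0 := by
    exact_mod_cast h'
  have hC2 : ¬ (2 : ℤ) ∣ C := fun h ↦ (Int.not_even_iff_odd.mpr hC) (even_iff_two_dvd.mpr h)
  have h2q : (2 : ℤ) ∣ (q : ℤ) := by
    have h4 : (2 : ℤ) ∣ C * (q : ℤ) ^ 3 :=
      ⟨-(2 * p ^ 3 + 2 * A * p ^ 2 * q + 2 * B * p * q ^ 2), by linear_combination hZ⟩
    rcases Int.prime_two.dvd_or_dvd h4 with h | h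
    · exact absurd h hC2
    · exact Int.prime_two.dvd_of_dvd_pow h
  obtain ⟨q', hq'⟩ := h2q
  have h2p : (2 : ℤ) ∣ p := by
    rw [hq'] at hZ
    have h8 : (4 : ℤ) * (p ^ 3 + 2 * (A * p ^ 2 * q' + 2 * B * p * q' ^ 2 + C * q' ^ 3)) = 0 := by
      linear_combination hZ
    have h8' := (mul_eq_zero.mp h8).resolve_left (by norm_num)
    exact Int.prime_two.dvd_of_dvd_pow (n := 3)
      ⟨-(A * p ^ 2 * q' + 2 * B * p * q' ^ 2 + C * q' ^ 3), by linear_combination h8'⟩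
  have hcop : p.natAbs.Coprime q := x.reduced
  have hg : 2 ∣ Nat.gcd p.natAbs q :=
    Nat.dvd_gcd (Int.natCast_dvd.mp h2p) (Int.natCast_dvd_natCast.mp ⟨q', hq'⟩)
  rw [hcop] at hg
  exact absurd hg (by norm_num)

/-- **`a₁` even, `a₃` odd, integral coefficients ⇒ the `2`-division cubic has no rational root.**
`4x³ + b₂x² + 2b₄x + b₆` with `b₂ = 4(s² + a₂)`, `2b₄ = 4(a₄ + s a₃)` (`a₁ = 2s`) and `b₆ = a₃² + 4a₆` odd.
[cite: SilvermanAEC2009, III.2.3 and Exercise 3.7(b)] -/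
theorem twoTorsionCubic_ne_zero_of_even_a₁_of_odd_a₃ (W₀ : WeierstrassCurve ℤ) (ha₁ : Even W₀.a₁)
    (ha₃ : Odd W₀.a₃) (x : ℚ) :
    4 * x ^ 3 + (W₀.map (Int.castRingHom ℚ)).b₂ * x ^ 2 + 2 * (W₀.map (Int.castRingHom ℚ)).b₄ * x +
      (W₀.map (Int.castRingHom ℚ)).b₆ ≠ 0 := by
  obtain ⟨s, hs⟩ := ha₁
  have hodd : Odd (W₀.a₃ ^ 2 + 4 * W₀.a₆) := by
    rw [show (4 : ℤ) * W₀.a₆ = 2 * (2 * W₀.a₆) by ring]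
    exact ha₃.pow.add_even (even_two_mul _)
  intro hx
  apply cubic_ne_zero_of_odd_const (s * s + W₀.a₂) (W₀.a₄ + s * W₀.a₃) (W₀.a₃ ^ 2 + 4 * W₀.a₆) hodd x
  rw [map_b₂, map_b₄, map_b₆, WeierstrassCurve.b₂, WeierstrassCurve.b₄, WeierstrassCurve.b₆, hs] at hx
  simp only [map_add, map_mul, map_pow, map_ofNat, eq_intCast] at hx
  push_cast at hx ⊢
  linear_combination hx

/-- **Good supersingular reduction at `2` ⇒ no rational `2`-torsion**: for a globally minimal `W/ℚ` with
`GoodSS W 2` (`W.HasGoodReductionAtPrime 2 ∧ 2 ∣ a₂(W)`), `#E(ℚ)[2] = ratTwoTorsionCard W = 1`. (The minimal model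
has `a₁` even and `a₃` odd, tree `even_a₁_and_odd_a₃_of_goodSS_two`; then the `2`-division cubic has no rational
root.) Equivalently: `E[2]` is irreducible, indeed already `E[2](ℚ₂) = 0`.
[cite: SilvermanAEC2009, III.2.3 and Exercise 3.7(b); VII.3] -/
theorem ratTwoTorsionCard_eq_one_of_goodSS_two (W : WeierstrassCurve ℚ) [W.IsGloballyMinimal] (hss : GoodSS W 2) :
    ratTwoTorsionCard W = 1 := by
  obtain ⟨ha₁, ha₃⟩ :=
    Summit.BirchSwinnertonDyer.Rank1Residual.Supersingular.even_a₁_and_odd_a₃_of_goodSS_two W hss.1 hss.2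
  refine ratTwoTorsionCard_eq_one_of_forall_not_isRoot W fun x hx ↦ ?_
  rw [isRoot_twoTorsionPolynomial_iff] at hx
  have e := map_integralModelInt W
  refine twoTorsionCubic_ne_zero_of_even_a₁_of_odd_a₃ (integralModelInt W) ha₁ ha₃ x ?_
  rw [e]
  exact hx

/-- `#E(ℚ)[2] = 1` unfolded: every `Γ_ℚ`-fixed geometric point `Q` with `2Q = O` is `O`. [folklore] -/
theorem eq_zero_of_fixed_of_two_smul_eq_zero_of_ratTwoTorsionCard_eq_one (W : WeierstrassCurve ℚ)
    (h1 : ratTwoTorsionCard W = 1) {Q : W.geomPoints} (h2 : (2 : ℤ) • Q = 0)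
    (hfix : ∀ σ : Field.absoluteGaloisGroup ℚ, σ • Q = Q) : Q = 0 := by
  rw [ratTwoTorsionCard, Nat.card_eq_one_iff_exists] at h1
  obtain ⟨Q₀, hQ₀⟩ := h1
  have hQmem : (⟨Q, (mem_geomTorsion_iff W 2 Q).mpr h2⟩ : geomTorsion W (2 : ℤ)) ∈
      MulAction.fixedPoints (Field.absoluteGaloisGroup ℚ) (geomTorsion W (2 : ℤ)) := fun σ ↦ by
    apply Subtype.ext
    rw [AddSubgroup.torsionBy.coe_smul]
    exact hfix σ
  have h0mem : (0 : geomTorsion W (2 : ℤ)) ∈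
      MulAction.fixedPoints (Field.absoluteGaloisGroup ℚ) (geomTorsion W (2 : ℤ)) := fun σ ↦ smul_zero σ
  have e1 := hQ₀ ⟨_, hQmem⟩
  have e2 := hQ₀ ⟨_, h0mem⟩
  exact congrArg Subtype.val (congrArg Subtype.val (e1.trans e2.symm))

end NoTwoTorsion

/-! ## §2. A cyclic isogeny of even degree has a rational `2`-torsion point in its kernel -/

section Cyclic

variable {K : Type*} [Field K] {W W' : WeierstrassCurve K}

/-- In a finite cyclic (additive) group of even order there is an element of order `2`, and it is the ONLY
non-zero element killed by `2`. [folklore] -/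
theorem exists_unique_two_torsion_of_isAddCyclic {G : Type*} [AddCommGroup G] [Finite G] [IsAddCyclic G]
    (heven : Even (Nat.card G)) :
    ∃ P : G, P ≠ 0 ∧ (2 : ℕ) • P = 0 ∧ ∀ Q : G, (2 : ℕ) • Q = 0 → Q = 0 ∨ Q = P := by
  classical
  haveI : Fintype G := Fintype.ofFinite G
  obtain ⟨g, hg⟩ := IsAddCyclic.exists_generator (α := G)
  obtain ⟨k, hk⟩ := heven
  have hord : addOrderOf g = Nat.card G := addOrderOf_eq_card_of_forall_mem_zmultiples hg
  have hpos : 0 < Nat.card G := Nat.card_pos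
  have hk0 : 0 < k := by omega
  refine ⟨k • g, ?_, ?_, ?_⟩
  · intro h0
    have hdvd := addOrderOf_dvd_of_nsmul_eq_zero h0
    rw [hord, hk] at hdvd
    exact absurd (Nat.le_of_dvd hk0 hdvd) (by omega)
  · rw [← mul_nsmul, show k * 2 = Nat.card G by omega, ← hord, addOrderOf_nsmul_eq_zero]
  · intro Q hQ
    by_contra hne
    push Not at hne
    -- three distinct solutions of `2 • x = 0` in a cyclic group
    have hle := IsAddCyclic.card_nsmul_eq_zero_le (α := G) (n := 2) two_pos
    have h3 : ({0, k • g, Q} : Finset G) ⊆ Finset.univ.filter (fun a : G ↦ 2 • a = 0) := by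
      intro a ha
      simp only [Finset.mem_insert, Finset.mem_singleton] at ha
      rw [Finset.mem_filter]
      refine ⟨Finset.mem_univ _, ?_⟩
      rcases ha with rfl | rfl | rfl
      · exact smul_zero _
      · rw [← mul_nsmul, show k * 2 = Nat.card G by omega, ← hord, addOrderOf_nsmul_eq_zero]
      · exact hQ
    have hkg0 : k • g ≠ 0 := by
      intro h0
      have hdvd := addOrderOf_dvd_of_nsmul_eq_zero h0
      rw [hord, hk] at hdvd
      exact absurd (Nat.le_of_dvd hk0 hdvd) (by omega)
    have hcard3 : ({0, k • g, Q} : Finset G).card = 3 := by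
      rw [Finset.card_insert_of_notMem, Finset.card_pair hne.2.symm]
      simp only [Finset.mem_insert, Finset.mem_singleton, not_or]
      exact ⟨hkg0.symm, hne.1.symm⟩
    have := (Finset.card_le_card h3).trans hle
    omega

/-- **A cyclic isogeny of even degree has a non-zero `Γ_K`-fixed `2`-torsion point in its kernel.** The kernel
`ker ψ ⊆ E(K̄)` is `Γ_K`-stable (`ψ` is defined over `K`) and cyclic of even order `deg ψ`; its unique element `P`
of order `2` is therefore fixed by every `σ ∈ Γ_K` (`σP` is again an element of order `2` of `ker ψ`).
[cite: SilvermanAEC2009, III.4 (Remark 4.13.2) and VIII.§1] -/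
theorem _root_.WeierstrassCurve.Isogeny.exists_fixed_twoTorsion_of_isCyclic_of_even_degree (ψ : Isogeny W W')
    (hcyc : ψ.IsCyclic) (heven : Even ψ.degree) :
    ∃ P : W.geomPoints, P ≠ 0 ∧ (2 : ℤ) • P = 0 ∧ ψ P = 0 ∧
      ∀ σ : Field.absoluteGaloisGroup K, σ • P = P := by
  haveI : IsAddCyclic ψ.toAddMonoidHom.ker := hcyc
  obtain ⟨P, hP0, hP2, huniq⟩ := exists_unique_two_torsion_of_isAddCyclic (G := ψ.toAddMonoidHom.ker) heven
  have hP2' : (2 : ℕ) • (P : W.geomPoints) = 0 := by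
    rw [← AddSubgroupClass.coe_nsmul, hP2, ZeroMemClass.coe_zero]
  have hPker : ψ P = 0 := P.2
  refine ⟨(P : W.geomPoints), fun h ↦ hP0 (Subtype.ext h), ?_, hPker, fun σ ↦ ?_⟩
  · rw [← natCast_zsmul] at hP2'
    exact_mod_cast hP2'
  · -- `σ • P ∈ ker ψ`, is killed by `2`, and is non-zero
    have hmem : σ • (P : W.geomPoints) ∈ ψ.toAddMonoidHom.ker := by
      rw [AddMonoidHom.mem_ker, Isogeny.coe_toAddMonoidHom, ψ.map_smul, hPker, smul_zero]
    have h2 : (2 : ℕ) • (⟨σ • (P : W.geomPoints), hmem⟩ : ψ.toAddMonoidHom.ker) = 0 := by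
      apply Subtype.ext
      rw [AddSubgroupClass.coe_nsmul, ZeroMemClass.coe_zero]
      change (2 : ℕ) • (σ • (P : W.geomPoints)) = 0
      rw [← smul_comm σ (2 : ℕ) (P : W.geomPoints), hP2', smul_zero]
    rcases huniq _ h2 with h | h
    · exfalso
      have h' : σ • (P : W.geomPoints) = 0 := congrArg Subtype.val h
      rw [smul_eq_zero_iff_eq] at h'
      exact hP0 (Subtype.ext h')
    · exact congrArg Subtype.val h

/-- **Over `ℚ`: no rational `2`-torsion ⇒ every cyclic `ℚ`-isogeny out of `W` has odd degree.**
[cite: SilvermanAEC2009, III.4 (Remark 4.13.2) and VIII.§1] -/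
theorem _root_.WeierstrassCurve.Isogeny.odd_degree_of_isCyclic_of_ratTwoTorsionCard_eq_one
    {W W' : WeierstrassCurve ℚ} (ψ : Isogeny W W') (hcyc : ψ.IsCyclic) (h1 : ratTwoTorsionCard W = 1) :
    Odd ψ.degree := by
  rcases Nat.even_or_odd ψ.degree with heven | hodd
  · obtain ⟨P, hP0, hP2, -, hfix⟩ := ψ.exists_fixed_twoTorsion_of_isCyclic_of_even_degree hcyc heven
    exact absurd (eq_zero_of_fixed_of_two_smul_eq_zero_of_ratTwoTorsionCard_eq_one W h1 hP2 hfix) hP0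
  · exact hodd

/-- **Good supersingular at `2` ⇒ every cyclic `ℚ`-isogeny out of `W` has odd degree.**
[cite: SilvermanAEC2009, III.4 and VII.3] -/
theorem _root_.WeierstrassCurve.Isogeny.odd_degree_of_isCyclic_of_goodSS_two {W W' : WeierstrassCurve ℚ}
    [W.IsGloballyMinimal] (hss : GoodSS W 2) (ψ : Isogeny W W') (hcyc : ψ.IsCyclic) : Odd ψ.degree :=
  ψ.odd_degree_of_isCyclic_of_ratTwoTorsionCard_eq_one hcyc (ratTwoTorsionCard_eq_one_of_goodSS_two W hss)

end Cyclic

/-! ## §3. The real multiplier of a `ℚ`-isogeny on Néron lattices: `αΛ_W ⊆ Λ_A`, `(deg ψ)·Λ_A ⊆ αΛ_W` -/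

section Lattice

/-- **The multiplier of a `ℚ`-isogeny on Néron lattices is real and has index `deg ψ`.** For a `ℚ`-isogeny
`ψ : W → A` of elliptic curves and period pairs `L_W, L_A` with `g₂ = c₄/12`, `g₃ = c₆/216` for the two models,
there is a REAL `α ≠ 0` with `αΛ_W ⊆ Λ_A` and `(deg ψ)·Λ_A ⊆ αΛ_W`. Proof: the tree's
`Isogeny.exists_mul_baseChange_apply_eq` (Silverman AEC VI.4.1(b): `ψ_ℂ(u(z)) = u'(αz)`, `#ker ψ_ℂ = [Λ_A : αΛ_W]`)
along an embedding `ℚ̄ → ℂ`; `α` is real because `ψ_ℂ` and both uniformizations commute with complex conjugation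
(`Isogeny.map_conj_baseChange`, `apply_conj_eq_map_of_uniformization`), so `(α − ᾱ)ℂ ⊆ Λ_A`; and
`#ker ψ_ℂ = #ker ψ = deg ψ` (`Isogeny.ker_baseChange_eq_map`), so `deg ψ` kills `Λ_A/αΛ_W`.
[cite: SilvermanAEC2009, Thm. VI.4.1(b) (PDF pp. 152–154) and VI.5.3] -/
theorem _root_.WeierstrassCurve.Isogeny.exists_real_mul_lattice_le_of_isNeronLatticeOf {W A : WeierstrassCurve ℚ}
    [W.IsElliptic] [A.IsElliptic] (ψ : Isogeny W A) {LW LA : PeriodPair}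
    (hLW : IsNeronLatticeOf (W.baseChange ℂ) LW) (hLA : IsNeronLatticeOf (A.baseChange ℂ) LA) :
    ∃ α : ℝ, α ≠ 0 ∧ (∀ z ∈ LW.lattice, (α : ℂ) * z ∈ LA.lattice) ∧
      ∀ b ∈ LA.lattice, ∃ z ∈ LW.lattice, (ψ.degree : ℂ) * b = (α : ℂ) * z := by
  classical
  -- an embedding `ℚ̄ → ℂ`
  set ι : AlgebraicClosure ℚ →ₐ[ℚ] ℂ :=
    (@IsAlgClosed.lift ℂ _ _ ℚ _ _ (AlgebraicClosure ℚ) _ _ (AlgebraicClosure.instAlgebra ℚ) _ _ _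
      (AlgebraicClosure.isAlgebraic ℚ)) with hι
  letI : Algebra (AlgebraicClosure ℚ) ℂ := ι.toRingHom.toAlgebra
  haveI : IsScalarTower ℚ (AlgebraicClosure ℚ) ℂ :=
    IsScalarTower.of_algebraMap_eq fun x ↦ (ι.commutes x).symm
  -- uniformizations of the two models
  obtain ⟨uW, hkerW, -, huW⟩ := PeriodPair.exists_addMonoidHom_of_g₂_g₃' hLW.1 hLW.2
  obtain ⟨uA, hkerA, -, huA⟩ := PeriodPair.exists_addMonoidHom_of_g₂_g₃' hLA.1 hLA.2
  obtain ⟨αc, hαc, hincl, happ, hcard⟩ :=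
    ψ.exists_mul_baseChange_apply_eq hLW.1 hLW.2 hLA.1 hLA.2 uW hkerW huW uA hkerA huA
  -- `α` is real
  obtain ⟨σc, hσc⟩ := exists_algHom_conj (K := ℚ) conj_algebraMap
  have hmemA : ∀ w, uA w = 0 ↔ w ∈ LA.lattice := fun w ↦ by
    rw [← SetLike.mem_coe, ← hkerA]; rfl
  have hreal : conj αc = αc := by
    refine PeriodPair.conj_eq_of_forall_mul_mem LA fun w ↦ ?_
    have e1 : uA (αc * conj w) = uA (conj αc * conj w) := by
      rw [← happ, apply_conj_eq_map_of_uniformization hLW.1 hLW.2 uW hkerW huW σc hσc w,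
        ← Isogeny.map_conj_baseChange ψ σc, happ,
        ← apply_conj_eq_map_of_uniformization hLA.1 hLA.2 uA hkerA huA σc hσc (αc * w), map_mul]
    have e2 : uA ((αc - conj αc) * conj w) = 0 := by
      rw [sub_mul, map_sub, e1, sub_self]
    have e3 := (hmemA _).mp e2
    -- use conjugation-stability of the real lattice `Λ_A`
    have hAreal : LA.IsReal := WeierstrassCurve.isReal_of_g₂_g₃_eq (K := ℚ) hLA.1 hLA.2
    have e4 : conj ((αc - conj αc) * conj w) ∈ LA.lattice := hAreal _ e3
    rw [map_mul, map_sub, Complex.conj_conj, Complex.conj_conj] at e4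
    -- `(conj αc - αc) * w ∈ Λ_A`, hence its negative
    have e5 := LA.lattice.neg_mem e4
    rw [show -((conj αc - αc) * w) = (αc - conj αc) * w by ring] at e5
    exact e5
  have hαre : ((αc.re : ℝ) : ℂ) = αc := by
    exact Complex.conj_eq_iff_re.mp hreal
  -- the degree kills `Λ_A / αΛ_W`
  have hdeg : Nat.card (ψ.baseChange (M := ℂ)).ker = ψ.degree := by
    rw [ψ.ker_baseChange_eq_map (M := ℂ), Isogeny.degree]
    exact (Nat.card_congr (ψ.toAddMonoidHom.ker.equivMapOfInjective _
      (Affine.Point.map_injective _)).toEquiv).symm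
  refine ⟨αc.re, ?_, ?_, ?_⟩
  · intro h0
    apply hαc
    rw [← hαre, h0, Complex.ofReal_zero]
  · intro z hz
    rw [hαre]
    exact hincl z hz
  · intro b hb
    have hmem : ψ.degree • b ∈ (LW.mulLeft αc hαc).lattice.toAddSubgroup := by
      rw [← hdeg, hcard]
      exact AddSubgroup.nsmul_relIndex_mem _ (show b ∈ LA.lattice.toAddSubgroup from hb)
    rw [Submodule.mem_toAddSubgroup, PeriodPair.mem_mulLeft_lattice] at hmem
    refine ⟨αc⁻¹ * (ψ.degree • b), hmem, ?_⟩
    rw [hαre, ← mul_assoc, mul_inv_cancel₀ hαc, one_mul, nsmul_eq_mul]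

end Lattice

/-! ## §4. (H2) of `…StarBridge` for a cyclic isogeny out of a curve good supersingular at `2` -/

section Assembly

/-- **Bridge hypothesis (H2).** For a globally minimal `W/ℚ` with good supersingular reduction at `2`, an elliptic
`A/ℚ`, a CYCLIC `ℚ`-isogeny `ψ : W → A`, and Néron period pairs `L_W, L_A`: there are a real `α ≠ 0` and an ODD `m`
(`= deg ψ`) with `αΛ_W ⊆ Λ_A` and `m·Λ_A ⊆ αΛ_W`. With `…StarBridge` and the optimal-quotient input (H1) this is
ITEM B5 for the depleted eigenform. [cite: SilvermanAEC2009, Thm. VI.4.1(b) and III.4] -/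
theorem exists_real_oddIndex_latticeBridge_of_goodSS_two (W A : WeierstrassCurve ℚ) [W.IsElliptic]
    [W.IsGloballyMinimal] [A.IsElliptic] (hss : GoodSS W 2) (ψ : Isogeny W A) (hcyc : ψ.IsCyclic)
    {LW LA : PeriodPair} (hLW : IsNeronLatticeOf (W.baseChange ℂ) LW)
    (hLA : IsNeronLatticeOf (A.baseChange ℂ) LA) :
    ∃ (α : ℝ) (m : ℕ), α ≠ 0 ∧ Odd m ∧ (∀ z ∈ LW.lattice, (α : ℂ) * z ∈ LA.lattice) ∧
      ∀ b ∈ LA.lattice, ∃ z ∈ LW.lattice, (m : ℂ) * b = (α : ℂ) * z := by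
  obtain ⟨α, hα, hincl, hidx⟩ := ψ.exists_real_mul_lattice_le_of_isNeronLatticeOf hLW hLA
  exact ⟨α, ψ.degree, hα, ψ.odd_degree_of_isCyclic_of_goodSS_two hss hcyc, hincl, hidx⟩

end Assembly


end Summit.BirchSwinnertonDyer.BirchSwinnertonDyer.Theorems.ThetaLayerLambdaCongruenceAtTwo

end
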